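import Summits.CriticalPhenomena.SAWScalingLimit.Theorems.SAWTotalPositivityCriticalBubbleBoundJoinDefs
import Literature.Probability.RandomPlanarGeometry.SAWPolygonSurgery

/-!
# Polygon surgery on `ℤ²`: replacing one edge, or a two-edge sub-path, of a polygon by a fresh
self-avoiding path (stubs `isPolygon_replace_edge`, `isPolygon_replace_two` of line
`docking-census-joining`, crux stmt-CriticalPhenomena-7117
`Summit.CriticalPhenomena.SAWScalingLimit.Theses.SAWTotalPositivity.CriticalBubbleBound`)

The generic tool behind Madras' joining modification (each of its local cases replaces a one- or
two-edge sub-path of a polygon by an explicit path through fresh cells):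

* `isPolygon_replace_edge` — if `s(a,b)` is an edge of a polygon `E` of `ℤ²` (the edge set of a
  cycle, `IsPolygon`) and `P : a ⇝ b` is a self-avoiding path of length `≥ 2` whose interior
  vertices are not vertices of `E`, then `(E ∖ {ab}) ∪ P` is a polygon with `#E - 1 + |P|` edges;
* `isPolygon_replace_two` — the same for a two-edge sub-path `a – c – b` of `E` (`a ≠ b`):
  `(E ∖ {ac, cb}) ∪ P` is a polygon with `#E - 2 + |P|` edges.

Both follow by opening the polygon at an edge (`IsPolygon.exists_isPath_erase` of
`SAWPolygonSurgery.lean`) and closing the opened path with `P` into a cycle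
(`SimpleGraph.Walk.IsPath.isCycle_append`). Everything here is [folklore].
-/

noncomputable section

open SimpleGraph
open Literature.Probability.LatticeModels
open Literature.Probability.RandomPlanarGeometry Literature.Probability.RandomPlanarGeometry.SAW

namespace Summit.CriticalPhenomena.SAWScalingLimit.Theorems.CriticalBubbleBound.Join

/-- Closing an opened polygon: a self-avoiding path `Q : b ⇝ a` all of whose vertices are
vertices of (the edges of) `E`, followed by a self-avoiding path `P : a ⇝ b` of length `≥ 2`
whose interior vertices are not vertices of `E`, is a cycle. [folklore] -/
private theorem isCycle_append_of_interior {V : Type*} {G : SimpleGraph V} {E : Finset (Sym2 V)}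
    {a b : V} {Q : G.Walk b a} {P : G.Walk a b} (hQ : Q.IsPath) (hP : P.IsPath)
    (h2 : 2 ≤ P.length) (hQs : ∀ x ∈ Q.support, ∃ e ∈ E, x ∈ e)
    (hPE : ∀ x ∈ P.support, x ≠ a → x ≠ b → ¬ ∃ e ∈ E, x ∈ e) : (Q.append P).IsCycle := by
  refine hQ.isCycle_append hP ?_ (Or.inr (by omega))
  intro x hxQ hxP
  -- `x ≠ b` (tail of a path starting at `b`) and `x ≠ a` (tail of a path starting at `a`)
  have hxb : x ≠ b := by
    rintro rfl
    have hnd := hQ.support_nodup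
    rw [← Walk.cons_tail_support, List.nodup_cons] at hnd
    exact hnd.1 hxQ
  have hxa : x ≠ a := by
    rintro rfl
    have hnd := hP.support_nodup
    rw [← Walk.cons_tail_support, List.nodup_cons] at hnd
    exact hnd.1 hxP
  exact hPE x (List.mem_of_mem_tail hxP) hxa hxb (hQs x (List.mem_of_mem_tail hxQ))

/-- **Replacing an edge of a polygon by a path.** If `s(a,b)` is an edge of a polygon `E` of `ℤ²`
and `P : a ⇝ b` is a self-avoiding path of length `≥ 2` whose interior vertices are not vertices
of `E`, then `(E ∖ {s(a,b)}) ∪ P.edges` is a polygon with `#E - 1 + |P|` edges. [folklore] -/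
theorem isPolygon_replace_edge : ∀ (E : Finset (Sym2 (Site 2))) (a b : Site 2) (P : (zdGraph 2).Walk a b), IsPolygon (zdGraph 2) E → s(a, b) ∈ E → P.IsPath → 2 ≤ P.length → (∀ x ∈ P.support, x ≠ a → x ≠ b → ¬ ∃ e ∈ E, x ∈ e) → IsPolygon (zdGraph 2) (E.erase s(a, b) ∪ P.edges.toFinset) ∧ (E.erase s(a, b) ∪ P.edges.toFinset).card + 1 = E.card + P.length := by
  intro E a b P hE hab hP h2 hPE
  -- open `E` at `ba`: a path `Q : b ⇝ a` with edges `E ∖ {ab}` through all vertices of `E`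
  have hba : s(b, a) ∈ E := by rw [Sym2.eq_swap]; exact hab
  obtain ⟨Q, hQ, hQe, -, hQl, hQs⟩ := hE.exists_isPath_erase hba
  have hcyc : (Q.append P).IsCycle :=
    isCycle_append_of_interior hQ hP h2 (fun x hx => (hQs x).1 hx) hPE
  have hedges : (Q.append P).edges.toFinset = E.erase s(a, b) ∪ P.edges.toFinset := by
    rw [Walk.edges_append, List.toFinset_append, hQe, Sym2.eq_swap]
  refine ⟨⟨b, _, hcyc, hedges⟩, ?_⟩
  rw [← hedges, List.toFinset_card_of_nodup hcyc.edges_nodup, Walk.length_edges,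
    Walk.length_append]
  omega

/-- **Replacing a two-edge sub-path of a polygon by a path.** If `a – c – b` (`a ≠ b`) are two
consecutive edges of a polygon `E` of `ℤ²` and `P : a ⇝ b` is a self-avoiding path of length
`≥ 2` whose interior vertices are not vertices of `E`, then `(E ∖ {s(a,c), s(c,b)}) ∪ P.edges` is
a polygon with `#E - 2 + |P|` edges (the vertex `c`, of degree two in `E`, is dropped).
[folklore] -/
theorem isPolygon_replace_two : ∀ (E : Finset (Sym2 (Site 2))) (a c b : Site 2) (P : (zdGraph 2).Walk a b), IsPolygon (zdGraph 2) E → s(a, c) ∈ E → s(c, b) ∈ E → a ≠ b → P.IsPath → 2 ≤ P.length → (∀ x ∈ P.support, x ≠ a → x ≠ b → ¬ ∃ e ∈ E, x ∈ e) → IsPolygon (zdGraph 2) (((E.erase s(a, c)).erase s(c, b)) ∪ P.edges.toFinset) ∧ (((E.erase s(a, c)).erase s(c, b)) ∪ P.edges.toFinset).card + 2 = E.card + P.length := by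
  intro E a c b P hE hac hcb hab hP h2 hPE
  -- open `E` at `ca`: a path `Q : c ⇝ a` with edges `E ∖ {ac}` through all vertices of `E`
  have hca : s(c, a) ∈ E := by rw [Sym2.eq_swap]; exact hac
  obtain ⟨Q, hQ, hQe, -, hQl, hQs⟩ := hE.exists_isPath_erase hca
  have hQe' : Q.edges.toFinset = E.erase s(a, c) := by rw [hQe, Sym2.eq_swap]
  clear hQe
  -- `cb` is an edge of `Q`, hence (a path starting at `c`) its first edge
  have hcbQ : s(c, b) ∈ Q.edges := by
    rw [← List.mem_toFinset, hQe', Finset.mem_erase]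
    refine ⟨fun h => ?_, hcb⟩
    rcases Sym2.eq_iff.1 h with ⟨h1, h2⟩ | ⟨-, h2⟩
    · exact hab (by rw [h2, h1])
    · exact hab h2.symm
  obtain ⟨t, ht, hte, htl, hts⟩ : ∃ t : (zdGraph 2).Walk b a, t.IsPath ∧
      t.edges.toFinset = (E.erase s(a, c)).erase s(c, b) ∧ t.length + 2 = E.card ∧
      ∀ x ∈ t.support, ∃ e ∈ E, x ∈ e := by
    cases Q with
    | nil => simp at hcbQ
    | cons h t =>
      rename_i y
      rw [Walk.cons_isPath_iff] at hQ
      rw [Walk.edges_cons, List.mem_cons] at hcbQ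
      rcases hcbQ with hcbQ | hcbQ
      · have hyb : y = b := (Sym2.congr_right.1 hcbQ).symm
        refine ⟨t.copy hyb rfl, ?_, ?_, ?_, fun x hx => ?_⟩
        · rw [Walk.isPath_copy]
          exact hQ.1
        · have hnot : s(c, y) ∉ t.edges.toFinset := fun h' =>
            hQ.2 (t.fst_mem_support_of_mem_edges (List.mem_toFinset.1 h'))
          rw [Walk.edges_cons, List.toFinset_cons] at hQe'
          rw [Walk.edges_copy, ← Finset.erase_insert hnot, hQe', hyb]
        · rw [Walk.length_cons] at hQl
          rw [Walk.length_copy]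
          omega
        · rw [Walk.support_copy] at hx
          exact (hQs x).1 (by rw [Walk.support_cons]; exact List.mem_cons_of_mem _ hx)
      · exact absurd (t.fst_mem_support_of_mem_edges hcbQ) hQ.2
  -- close `t : b ⇝ a` with `P`
  have hcyc : (t.append P).IsCycle := isCycle_append_of_interior ht hP h2 hts hPE
  have hedges : (t.append P).edges.toFinset =
      ((E.erase s(a, c)).erase s(c, b)) ∪ P.edges.toFinset := by
    rw [Walk.edges_append, List.toFinset_append, hte]
  refine ⟨⟨b, _, hcyc, hedges⟩, ?_⟩
  rw [← hedges, List.toFinset_card_of_nodup hcyc.edges_nodup, Walk.length_edges,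
    Walk.length_append]
  omega

end Summit.CriticalPhenomena.SAWScalingLimit.Theorems.CriticalBubbleBound.Join

end
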